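import Summits.HubbardSuperconductivity.HubbardSuperconductivity.Theorems.NodalWardXYPerturbedXYOrderMeanFieldBounds
import Summits.HubbardSuperconductivity.HubbardSuperconductivity.Theorems.NodalWardXYPerturbedXYOrderLaplace

/-!
# `PerturbedXYOrder` (stmt-HubbardSuperconductivity-10739) — line `schwarz-inheritance`, stub `stub_relWardJensenBound`

Tools (II) for the negative lemma N10′ of lead c19 (`Theorems/PerturbedXYOrder/Negative/InvariantRelBoundedPinching.lean`): size and
Ward-identity mean of the energy-weighted source `R(θ) = Σ_y Σ_b (cos(θ_{b₁} − θ_y) + cos(θ_{b₂} − θ_y))(1 − cos ∇_bθ)`: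

* `gr_abs_R_le_energy` — **relative form-boundedness**: `|R| ≤ 2L³ Σ_b (1 − cos ∇_bθ)` (so the tilt `(s/L³)R` is in Balaban's
  small/large-field class `|W| ≤ C Σ_b(1 − cos∇_bθ)`, exactly as the crux's `W_K`); `gr_abs_R_le`: `|R| ≤ 12L⁶`;
* `gr_ward_R` — **the Ward side**: `J ∫ R w_J = Σ_{x,y} ∫ cos(θ_x − θ_y) w_J − L³ ∫ w_J` (`R = Σ_{x,y} sin(θ_x−θ_y) S_x`, `cfw_sum_sin_S`, and the
  rotator Ward identity `cfw_ward_sum`, p153040): long-range order forces `⟨R⟩_J ≥ (a₀L⁶ − L³)/J`;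
* `gr_rel_lower_pos` = registered stub `stub_relWardJensenBound`: Jensen, `log ⟨e^{σR/L³}⟩_J ≥ σ(L³ Re cratio(L,J,0) − 1)/J` (`J > 0`).
-/

noncomputable section

namespace Summit.HubbardSuperconductivity.HubbardSuperconductivity.Theorems.PerturbedXYOrder

open MeasureTheory Literature.Probability.LatticeModels Metric Set
open Summit.HubbardSuperconductivity.HubbardSuperconductivity.Theses.NodalWardXY

variable {L : ℕ}

/-- **Relative form-boundedness of the energy-weighted source**: `|R(θ)| ≤ 2L³ Σ_b (1 − cos ∇_bθ)` — the tilt `(s/L³) R` is bounded by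
`2|s|` times the gradient energy (Balaban's small/large-field class). -/
theorem gr_abs_R_le_energy [NeZero L] (θ : TorusSite 3 L → ℝ) :
    |∑ y : TorusSite 3 L, ∑ b : Bond L, (Real.cos (θ b.1 - θ y) + Real.cos (θ (b.1 + Pi.single b.2 1) - θ y)) *
        (1 - Real.cos (θ (b.1 + Pi.single b.2 1) - θ b.1))| ≤
      2 * (L : ℝ) ^ 3 * ∑ b : Bond L, (1 - Real.cos (θ (b.1 + Pi.single b.2 1) - θ b.1)) := by
  refine (Finset.abs_sum_le_sum_abs _ _).trans ?_
  calc ∑ y : TorusSite 3 L, |∑ b : Bond L, (Real.cos (θ b.1 - θ y) + Real.cos (θ (b.1 + Pi.single b.2 1) - θ y)) *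
        (1 - Real.cos (θ (b.1 + Pi.single b.2 1) - θ b.1))|
      ≤ ∑ _y : TorusSite 3 L, 2 * ∑ b : Bond L, (1 - Real.cos (θ (b.1 + Pi.single b.2 1) - θ b.1)) := by
        refine Finset.sum_le_sum fun y _ => (Finset.abs_sum_le_sum_abs _ _).trans ?_
        rw [Finset.mul_sum]
        refine Finset.sum_le_sum fun b _ => ?_
        have hd : 0 ≤ 1 - Real.cos (θ (b.1 + Pi.single b.2 1) - θ b.1) := by
          linarith [Real.cos_le_one (θ (b.1 + Pi.single b.2 1) - θ b.1)]
        rw [abs_mul, abs_of_nonneg hd]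
        refine mul_le_mul_of_nonneg_right ((abs_add_le _ _).trans ?_) hd
        linarith [Real.abs_cos_le_one (θ b.1 - θ y), Real.abs_cos_le_one (θ (b.1 + Pi.single b.2 1) - θ y)]
    _ = 2 * (L : ℝ) ^ 3 * ∑ b : Bond L, (1 - Real.cos (θ (b.1 + Pi.single b.2 1) - θ b.1)) := by
        rw [Finset.sum_const, Finset.card_univ, nsmul_eq_mul, cfp_card]; ring

/-- `|R(θ)| ≤ 12 L⁶`. -/
theorem gr_abs_R_le [NeZero L] (θ : TorusSite 3 L → ℝ) :
    |∑ y : TorusSite 3 L, ∑ b : Bond L, (Real.cos (θ b.1 - θ y) + Real.cos (θ (b.1 + Pi.single b.2 1) - θ y)) *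
        (1 - Real.cos (θ (b.1 + Pi.single b.2 1) - θ b.1))| ≤ 12 * ((L : ℝ) ^ 3) ^ 2 := by
  refine (gr_abs_R_le_energy θ).trans ?_
  have := fv_energy_le θ
  have hL : (0 : ℝ) ≤ (L : ℝ) ^ 3 := by positivity
  nlinarith

/-- **The Ward side.** `J ∫ R w_J = Σ_{x,y} ∫ cos(θ_x − θ_y) w_J − L³ ∫ w_J` (`R = Σ_{x,y} sin(θ_x − θ_y) S_x` by `cfw_sum_sin_S`, then the
rotator Ward identity `cfw_ward_sum`, p153040). -/
theorem gr_ward_R [NeZero L] (J : ℝ) :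
    J * ∫ θ in cube L, (∑ y : TorusSite 3 L, ∑ b : Bond L,
        (Real.cos (θ b.1 - θ y) + Real.cos (θ (b.1 + Pi.single b.2 1) - θ y)) *
          (1 - Real.cos (θ (b.1 + Pi.single b.2 1) - θ b.1))) * (wJ J θ).re =
      (∑ x : TorusSite 3 L, ∑ y : TorusSite 3 L, ∫ θ in cube L, Real.cos (θ x - θ y) * (wJ J θ).re) -
        (L : ℝ) ^ 3 * ∫ θ in cube L, (wJ J θ).re := by
  classical
  have hwc : Continuous fun θ : TorusSite 3 L → ℝ => (wJ J θ).re := gp_continuous_wJ_re J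
  have hRint : ∫ θ in cube L, (∑ y : TorusSite 3 L, ∑ b : Bond L,
        (Real.cos (θ b.1 - θ y) + Real.cos (θ (b.1 + Pi.single b.2 1) - θ y)) *
          (1 - Real.cos (θ (b.1 + Pi.single b.2 1) - θ b.1))) * (wJ J θ).re =
      ∑ x : TorusSite 3 L, ∑ y : TorusSite 3 L, ∫ θ in cube L, Real.sin (θ x - θ y) *
        (∑ b : Bond L, Real.sin (θ (b.1 + Pi.single b.2 1) - θ b.1) *
          ((Pi.single x (1 : ℝ) : TorusSite 3 L → ℝ) (b.1 + Pi.single b.2 1) -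
            (Pi.single x (1 : ℝ) : TorusSite 3 L → ℝ) b.1)) * (wJ J θ).re := by
    have hxy : ∀ x y : TorusSite 3 L, Integrable (fun θ : TorusSite 3 L → ℝ => Real.sin (θ x - θ y) *
        (∑ b : Bond L, Real.sin (θ (b.1 + Pi.single b.2 1) - θ b.1) *
          ((Pi.single x (1 : ℝ) : TorusSite 3 L → ℝ) (b.1 + Pi.single b.2 1) -
            (Pi.single x (1 : ℝ) : TorusSite 3 L → ℝ) b.1)) * (wJ J θ).re) (volume.restrict (cube L)) := by
      intro x y
      refine gp_integrable ?_
      exact ((by fun_prop : Continuous fun θ : TorusSite 3 L → ℝ => Real.sin (θ x - θ y) *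
        (∑ b : Bond L, Real.sin (θ (b.1 + Pi.single b.2 1) - θ b.1) *
          ((Pi.single x (1 : ℝ) : TorusSite 3 L → ℝ) (b.1 + Pi.single b.2 1) -
            (Pi.single x (1 : ℝ) : TorusSite 3 L → ℝ) b.1))).mul hwc)
    rw [Finset.sum_comm]
    have h1 : ∀ y : TorusSite 3 L, ∑ x : TorusSite 3 L, ∫ θ in cube L, Real.sin (θ x - θ y) *
        (∑ b : Bond L, Real.sin (θ (b.1 + Pi.single b.2 1) - θ b.1) *
          ((Pi.single x (1 : ℝ) : TorusSite 3 L → ℝ) (b.1 + Pi.single b.2 1) -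
            (Pi.single x (1 : ℝ) : TorusSite 3 L → ℝ) b.1)) * (wJ J θ).re =
        ∫ θ in cube L, ∑ x : TorusSite 3 L, Real.sin (θ x - θ y) *
          (∑ b : Bond L, Real.sin (θ (b.1 + Pi.single b.2 1) - θ b.1) *
            ((Pi.single x (1 : ℝ) : TorusSite 3 L → ℝ) (b.1 + Pi.single b.2 1) -
              (Pi.single x (1 : ℝ) : TorusSite 3 L → ℝ) b.1)) * (wJ J θ).re :=
      fun y => (integral_finsetSum _ fun x _ => hxy x y).symm
    simp_rw [h1]
    rw [← integral_finsetSum _ fun y _ => integrable_finsetSum _ fun x _ => hxy x y]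
    refine integral_congr_ae (ae_of_all _ fun θ => ?_)
    dsimp only
    rw [Finset.sum_mul]
    refine Finset.sum_congr rfl fun y _ => ?_
    rw [← Finset.sum_mul, cfw_sum_sin_S θ (θ y)]
  rw [hRint]
  have hw := cfw_ward_sum (L := L) J
  simp only [gp_wJ_re]
  rw [hw, cfp_card]

/-- **Jensen side for the energy-weighted source** (`J > 0`): `log ⟨e^{σR/L³}⟩_J ≥ σ (L³ Re cratio(L,J,0) − 1)/J`
(Jensen `gp_jensen` + the Ward identity `gr_ward_R`: `⟨R⟩_J = (L⁶ Re cratio − L³)/J`). -/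
theorem gr_rel_lower_pos [NeZero L] {J : ℝ} (hJ : 0 < J) (σ : ℝ) :
    σ * ((L : ℝ) ^ 3 * (cratio L J (0 : Bond L → Bond L → ℂ)).re - 1) / J ≤
      Real.log ((∫ θ in cube L, Real.exp (σ * ((∑ y : TorusSite 3 L, ∑ b : Bond L,
        (Real.cos (θ b.1 - θ y) + Real.cos (θ (b.1 + Pi.single b.2 1) - θ y)) *
          (1 - Real.cos (θ (b.1 + Pi.single b.2 1) - θ b.1))) / (L : ℝ) ^ 3)) * (wJ J θ).re) /
        ∫ θ in cube L, (wJ J θ).re) := by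
  have hL0 : (0 : ℝ) < L := by have := NeZero.pos L; exact_mod_cast this
  have hZ : 0 < ∫ θ in cube L, (wJ J θ).re := gp_integral_wJ_re_pos J
  have hJen := gp_jensen (L := L) J (Ψ := fun θ => σ * ((∑ y : TorusSite 3 L, ∑ b : Bond L,
        (Real.cos (θ b.1 - θ y) + Real.cos (θ (b.1 + Pi.single b.2 1) - θ y)) *
          (1 - Real.cos (θ (b.1 + Pi.single b.2 1) - θ b.1))) / (L : ℝ) ^ 3)) (by fun_prop)
  refine le_trans (le_of_eq ?_) hJen
  have hre : (cratio L J (0 : Bond L → Bond L → ℂ)).re =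
      (∑ x : TorusSite 3 L, ∑ y : TorusSite 3 L, ∫ θ in cube L, Real.cos (θ x - θ y) * (wJ J θ).re) /
        ((∫ θ in cube L, (wJ J θ).re) * (L : ℝ) ^ 6) := by
    rw [even_re_cratio_zero]; rfl
  have hint : ∫ θ in cube L, σ * ((∑ y : TorusSite 3 L, ∑ b : Bond L,
        (Real.cos (θ b.1 - θ y) + Real.cos (θ (b.1 + Pi.single b.2 1) - θ y)) *
          (1 - Real.cos (θ (b.1 + Pi.single b.2 1) - θ b.1))) / (L : ℝ) ^ 3) * (wJ J θ).re =
      σ / (L : ℝ) ^ 3 * ∫ θ in cube L, (∑ y : TorusSite 3 L, ∑ b : Bond L,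
        (Real.cos (θ b.1 - θ y) + Real.cos (θ (b.1 + Pi.single b.2 1) - θ y)) *
          (1 - Real.cos (θ (b.1 + Pi.single b.2 1) - θ b.1))) * (wJ J θ).re := by
    rw [← integral_const_mul]
    refine integral_congr_ae (ae_of_all _ fun θ => ?_)
    simp only
    ring
  have hward := gr_ward_R (L := L) J
  have hR : ∫ θ in cube L, (∑ y : TorusSite 3 L, ∑ b : Bond L,
        (Real.cos (θ b.1 - θ y) + Real.cos (θ (b.1 + Pi.single b.2 1) - θ y)) *
          (1 - Real.cos (θ (b.1 + Pi.single b.2 1) - θ b.1))) * (wJ J θ).re =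
      ((∑ x : TorusSite 3 L, ∑ y : TorusSite 3 L, ∫ θ in cube L, Real.cos (θ x - θ y) * (wJ J θ).re) -
        (L : ℝ) ^ 3 * ∫ θ in cube L, (wJ J θ).re) / J := by
    rw [eq_div_iff hJ.ne', mul_comm]
    exact hward
  rw [hint, hR, hre]
  field_simp

/-- STUB `stub_relWardJensenBound` (registered on stmt-HubbardSuperconductivity-10739, line `schwarz-inheritance`, lead c19, rev 20): the
**Ward–Jensen side** for the energy-weighted source, `log ⟨e^{σR/L³}⟩_J ≥ σ(L³ Re cratio(L,J,0) − 1)/J` for `J > 0` (= `gr_rel_lower_pos`). [folklore] -/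
theorem stub_relWardJensenBound : ∀ (J : ℝ), 0 < J → ∀ (L : ℕ) [NeZero L] (σ : ℝ),
    σ * ((L : ℝ) ^ 3 * (cratio L J (0 : Bond L → Bond L → ℂ)).re - 1) / J ≤
      Real.log ((∫ θ in cube L, Real.exp (σ * ((∑ y : TorusSite 3 L, ∑ b : Bond L,
        (Real.cos (θ b.1 - θ y) + Real.cos (θ (b.1 + Pi.single b.2 1) - θ y)) *
          (1 - Real.cos (θ (b.1 + Pi.single b.2 1) - θ b.1))) / (L : ℝ) ^ 3)) * (wJ J θ).re) /
        ∫ θ in cube L, (wJ J θ).re) :=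
  fun _J hJ _L _ σ => gr_rel_lower_pos hJ σ

end Summit.HubbardSuperconductivity.HubbardSuperconductivity.Theorems.PerturbedXYOrder

end
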